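import Mathlib
import Summits.AnomalousDissipation.AnomalousDissipation.Theses.PointSink
import Literature.Analysis.FluidPDE.StationaryEulerLaminatesHighDim
import Literature.Analysis.FluidPDE.StationaryEulerLaminateWaves
import Literature.Analysis.FluidPDE.StationaryEulerTorusGrid
import Literature.Analysis.FluidPDE.VectorCalculus
import Summits.AnomalousDissipation.AnomalousDissipation.Theorems.PointSinkPointFluxConePressurelessLaminate
import Summits.AnomalousDissipation.AnomalousDissipation.Theorems.PointSinkPointFluxConePressurelessTwoState
import Summits.AnomalousDissipation.AnomalousDissipation.Theorems.PointSinkPointFluxConePressurelessPacket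
import Summits.AnomalousDissipation.AnomalousDissipation.Theorems.PointSinkPointFluxConeBoxStep
import Summits.AnomalousDissipation.AnomalousDissipation.Theorems.PointSinkPointFluxConeBoxIteration
import Summits.AnomalousDissipation.AnomalousDissipation.Theorems.PointSinkPointFluxConeReplicate
import Summits.AnomalousDissipation.AnomalousDissipation.Theorems.PointSinkPointFluxConeWildBox
import HarnessLib

/-!
# Crux `PointSink.PointFluxCone` (stmt-AnomalousDissipation-19033) — PROVED by line `Sketch`
  (dilation-periodised wild box, pressureless Tartar-framework engine)

`PointFluxCone_of : Summit.AnomalousDissipation.AnomalousDissipation.Theses.PointSink.PointFluxCone`.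
The crux asks for a discretely self-similar (degrees `(-2/3,-4/3)`)
weak stationary Euler pair `(V, P)` off the origin of `ℝ³` with NON-ZERO log-mean radial energy flux
over the fundamental shell.  The line:

* **Wild box.** Run the tree's explicit stationary convex-integration scheme
  (`Literature.Analysis.FluidPDE.StationaryEuler*`, Choffrut–Székelyhidi 2014) in the open unit box
  `(0,1)³ ⊂ ℝ³` instead of `T³`, from the strict subsolution `(v₀, 0, 0)` (`3|v₀|² < e`), with two
  additions: (i) the laminates of finite order are PRESSURELESS (every splitting certificate has
  `q = 0`; in `d = 3` the stress gap is absorbed by pairwise exchange splits `fᵢ⊗fᵢ − fⱼ⊗fⱼ`, kernel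
  `f_k`, followed by the tree's velocity splits `vLam`), so every wave certificate is trace free and
  the packet pressure `prC` is a lower-order term, made `≤ δ_k` in sup norm at step `k`; (ii) the
  pressures are carried along, `π = Σ_k prC_k` converges uniformly.  The limit is a bounded,
  compactly supported weak Euler pair `(W, P)`, `P = π − |W|²/3`, with PRESCRIBED Bernoulli function
  `½|W|² + P = e/6 + π` on the box; its log-radial Bernoulli moment about the far point `−c`,
  `∫ (½|W|²+P) ⟪W, x+c⟫/‖x+c‖²`, equals `(1/6)∫⟪v₀,x+c⟫²/‖x+c‖² + O(θ + δ)` for the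
  non-constant energy profile `e = E₀ + ⟪v₀, x + c⟫` (the constant part drops out because
  `(x+c)/‖x+c‖²` is a gradient and `W` is weakly divergence free), hence is non-zero.
* **Replication.** Translate the box to `c + (0,1)³ ⊂ {1 < |y| < 8}` (`c = 3e₀`) and replicate along
  the dilation orbit, `V(y) = Σ_{k∈ℤ} 8^{-2k/3} W(8^{-k}y − c)` (locally one term): exactly DSS, weak
  Euler and weakly divergence free off the origin by scaling covariance and disjointness of the
  shells, and the crux's flux integral over `{1 < |y| < 8}` is the box moment above.

Seven registered stubs, composed by `PointFluxCone_of` (pure modus ponens; each stub from the third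
on is an implication from the previous stub's conclusion, restated verbatim):
`stub_pressurelessLaminate` (PL, finite-dimensional), `stub_pressurelessTwoState` (PTS, Lemma 4 with
the trace bound), `stub_pressurelessPacket : PL → PTS → PPK` (Prop. 6 with pressure),
`stub_boxStep : PPK → STEP` (§2 Step 3 in the box, with pressure), `stub_boxIteration : STEP → ITER`
(the explicit iteration, energies, Cauchy, defects), `stub_wildBox : ITER → WILDBOX` (seed design,
limit, weak Euler with pressure, the moment), `stub_replicate : WILDBOX → PointFluxCone`.

HONEST CAVEAT (for the route, not a defect of the crux as typed): the witness carries no energy flux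
between shells and a SIGNED Duchon–Robert defect inside each box copy (net zero per fundamental
shell); the non-zero "flux log-mean" is a bulk-roughness moment (`⟨D, log|x|⟩`).  `V ∈ L^∞_loc` off
the origin and `P` is bounded but discontinuous across the faces of the box copies.  By the landed
classical rigidity (`Theorems/PointFluxCone/Negative/ClassicalFluxRigidity*.lean`) no `C¹`-off-origin
witness exists, so roughness of this kind is forced.
-/

noncomputable section

open scoped InnerProductSpace ContDiff ENNReal Topology
open Set Function MeasureTheory Metric Filter
open Literature.Analysis.FluidPDE Literature.Analysis.FluidPDE.StationaryEuler
open Literature.Analysis.FunctionSpaces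

set_option linter.dupNamespace false

namespace Summit.AnomalousDissipation.AnomalousDissipation.Theorems

/-! ## The seven stubs — all LANDED

* `stub_pressurelessLaminate` — Theorems/PointSinkPointFluxConePressurelessLaminate.lean (p160081)
* `stub_pressurelessTwoState` — Theorems/PointSinkPointFluxConePressurelessTwoState.lean (p160682)
* `stub_pressurelessPacket` — Theorems/PointSinkPointFluxConePressurelessPacket.lean (+Tools) (p161750)
* `stub_boxStep` — Theorems/PointSinkPointFluxConeBoxStep.lean (+Tools) (p161719)
* `stub_boxIteration` — Theorems/PointSinkPointFluxConeBoxIteration.lean (+Tools) (p161989)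
* `stub_wildBox` — Theorems/PointSinkPointFluxConeWildBox.lean (+SeedTools, +LimitTools)
* `stub_replicate` — Theorems/PointSinkPointFluxConeReplicate.lean (+Tools) (p162250)

all in namespace `Summit.AnomalousDissipation.AnomalousDissipation.Theorems`, imported above. -/

/-! ## Composition -/

/-- **The line closes the crux modulo its seven registered stubs** (pure modus ponens:
`stub_replicate (stub_wildBox (stub_boxIteration (stub_boxStep (stub_pressurelessPacket
stub_pressurelessLaminate stub_pressurelessTwoState))))`). -/
theorem PointFluxCone_of :
    Summit.AnomalousDissipation.AnomalousDissipation.Theses.PointSink.PointFluxCone :=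
  stub_replicate (stub_wildBox (stub_boxIteration (stub_boxStep
    (stub_pressurelessPacket stub_pressurelessLaminate stub_pressurelessTwoState))))

end Summit.AnomalousDissipation.AnomalousDissipation.Theorems

end
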